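import Mathlib

/-!
# DetDenomBookkeeping — determinant-denominator bookkeeping lemmas of cell zeta5-irr (zi-p2's DL1, DL2, DL2-max, DL3 (ii) instance)

HONEST FRAMING: systematic search; no irrationality claim unless certified. These are INSTRUMENT lemmas of the
ζ(5) census cell zeta5-irr (HOME `run/shared/lean/pub/zeta5-irr/`, memo `zi-p2/LEMMAS.md` §A10/§B6, finding
`zi-p2/FINDINGS-DENOM.md` §2.8–2.9): elementary `p`-adic bookkeeping for the denominators of Gram/Hankel determinants of
exact linear forms, and the finite permutation combinatorics of INDEX-MODEL denominator laws. Nothing here is about ζ(5);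
no irrationality content; filing moves no rung.

Contents (proofs = the cell's pinned files, `zi-p2/MANIFEST.sha16`; changes confined to: namespace rename, the duplicated block-reversal
lemmas of DL2/DL2Max merged, the sketch's `def … : Prop` wrappers + `_holds` replaced by the bare theorems they wrap (reviewer preference
recorded for F5/F6, p406200), named instead of anonymous instance checks, docstrings):
* §1 **DL1** (`zi-p2/DL1.lean`, sha256 b90c23c4…, author zi-p2 g2): `v_p(den det M) ≤ max_σ Σ_i v_p(den M_{i,σ i})`
  `≤ Σ_i max_j v_p(den M_{i,j})` for every square rational matrix and every prime (Leibniz expansion + ultrametric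
  inequality) — the «assignment bound» A_p and the «row-lcm bound» R_p of the cell's gramdet engine (zeng ≥ 1.1.4).
* §2 **DL2** (`zi-p2/DL2.lean`, 0b4266f7…, zi-p2 g3): for a ONE-threshold monotone index law `k₀ ≤ r + i + j` a single
  permutation (block reversal) reaches the threshold in every row that can reach it: A = R, no large-prime gain.
* §3 **DL2-max** (`zi-p2/DL2Max.lean` v2, 217cd705…, zi-p2 g3): the same for MAX-type laws (one threshold per coordinate),
  2-D product form and `d`-dimensional `Fin d → Fin N` form. NOT claimed: multi-threshold laws, where A < R does occur.
* §4 **DL3 (ii) boundary instance** (`zi-p2/DL3SumLawInstance.lean`, 00f751bd…, zi-p2 g3): for a one-threshold law in the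
  TOTAL degree (sum law) the assignment bound is strictly below the row-lcm bound already at `N = 2` (`A = 2 < R = 3`),
  `decide`-certified. The continuum constants `8/9`, `49/54` of LEMMAS §A10 are NOT proved here.
The generic companions DL4 (unimodular change of basis) and B1 (prime-power corank divides det) are in
`Literature/LinearAlgebra/Matrix/DetPrimePowCorank.lean` (p406200). Referee kernel replays of the pinned bytes: zi-ref ROUNDS R2.1
(DL2, DL2Max, DL3 instance; DL1 = Round-1 standing). Filed Summits-side by the cell's engine seat zi-eng (g2) — the cell's only
seat with Summits propose rights — from the author seat's hand-over table `zi-p2/FILING-F1-F6.md`, under the ladder director's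
standing line of 2026-08-25T18:36:48Z («lemmas filed as Literature/Theorems»). Mathematical statements unchanged.
-/

namespace Summit.KontsevichZagierPeriods.Zeta5Search.DetDenom
open Finset

/-! ## §1 DL1 — the assignment bound for `v_p(den det M)` -/

section
variable {p : ℕ} [hp : Fact p.Prime]

omit hp in
/-- `-v_p(den q) ≤ v_p(q)` (from the definition `v_p(q) = v_p(num q) - v_p(den q)`). -/
theorem neg_den_le_padicValRat (q : ℚ) :
    -((padicValNat p q.den : ℕ) : ℤ) ≤ padicValRat p q := by
  have h : padicValRat p q = (padicValNat p q.num.natAbs : ℤ) - (padicValNat p q.den : ℤ) := rfl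
  rw [h]
  have : (0 : ℤ) ≤ (padicValNat p q.num.natAbs : ℤ) := by exact_mod_cast Nat.zero_le _
  omega

/-- If `v_p(q) ≥ -A` then `v_p(den q) ≤ A`. -/
theorem padicValNat_den_le_of_le (q : ℚ) (A : ℕ) (h : -(A : ℤ) ≤ padicValRat p q) :
    padicValNat p q.den ≤ A := by
  by_cases hd : p ∣ q.den
  · have hnum : ¬ p ∣ q.num.natAbs := by
      intro hn
      have hcop : Nat.Coprime q.num.natAbs q.den := q.reduced
      have h1 : p ∣ Nat.gcd q.num.natAbs q.den := Nat.dvd_gcd hn hd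
      rw [hcop] at h1
      exact hp.out.one_lt.ne' (Nat.dvd_one.mp h1)
    have hv : padicValRat p q = (padicValNat p q.num.natAbs : ℤ) - (padicValNat p q.den : ℤ) := rfl
    rw [hv, padicValNat.eq_zero_of_not_dvd hnum, Nat.cast_zero, zero_sub] at h
    omega
  · rw [padicValNat.eq_zero_of_not_dvd hd]; exact Nat.zero_le _

/-- `v_p` of a product of non-zero rationals is the sum of the `v_p`. -/
theorem padicValRat_prod {ι : Type*} (s : Finset ι) (F : ι → ℚ) (hF : ∀ i ∈ s, F i ≠ 0) :
    padicValRat p (∏ i ∈ s, F i) = ∑ i ∈ s, padicValRat p (F i) := by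
  classical
  induction s using Finset.induction_on with
  | empty => simp
  | insert a s ha ih =>
    have hs : ∏ i ∈ s, F i ≠ 0 :=
      Finset.prod_ne_zero_iff.mpr (fun i hi => hF i (mem_insert_of_mem hi))
    rw [Finset.prod_insert ha, Finset.sum_insert ha,
      padicValRat.mul (hF a (mem_insert_self a s)) hs,
      ih (fun i hi => hF i (mem_insert_of_mem hi))]

/-- Ultrametric lower bound for a finite sum: if every non-zero term has `v_p ≥ c` and the sum is
non-zero then the sum has `v_p ≥ c`. -/
theorem le_padicValRat_sum {ι : Type*} (s : Finset ι) {F : ι → ℚ} (c : ℤ)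
    (hF : ∀ i ∈ s, F i ≠ 0 → c ≤ padicValRat p (F i)) (hs : ∑ i ∈ s, F i ≠ 0) :
    c ≤ padicValRat p (∑ i ∈ s, F i) := by
  classical
  induction s using Finset.induction_on with
  | empty => simp at hs
  | insert a s ha ih =>
    rw [Finset.sum_insert ha] at hs ⊢
    by_cases h0 : ∑ i ∈ s, F i = 0
    · rw [h0, add_zero] at hs ⊢
      exact hF a (mem_insert_self a s) hs
    · have h1 := ih (fun i hi => hF i (mem_insert_of_mem hi)) h0
      by_cases ha0 : F a = 0
      · rw [ha0, zero_add]; exact h1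
      have h2 := hF a (mem_insert_self a s) ha0
      exact le_trans (le_min h2 h1) (padicValRat.min_le_padicValRat_add hs)

/-- DL1, column form: `v_p(den det M) ≤ max_σ Σ_i v_p(den M_{σ i, i})`. -/
theorem det_den_padicValNat_le_col {N : ℕ} (M : Matrix (Fin N) (Fin N) ℚ) :
    padicValNat p M.det.den ≤
      univ.sup (fun σ : Equiv.Perm (Fin N) => ∑ i, padicValNat p (M (σ i) i).den) := by
  classical
  set A := univ.sup (fun σ : Equiv.Perm (Fin N) => ∑ i, padicValNat p (M (σ i) i).den) with hA
  apply padicValNat_den_le_of_le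
  by_cases hdet : M.det = 0
  · rw [hdet]; simp
  rw [Matrix.det_apply'] at hdet ⊢
  refine le_padicValRat_sum _ (-(A : ℤ)) (fun σ _ hσ => ?_) hdet
  have hprod : ∏ i, M (σ i) i ≠ 0 := by
    intro h; apply hσ; rw [h, mul_zero]
  have hsgn0 : ((Equiv.Perm.sign σ : ℤ) : ℚ) ≠ 0 := by
    exact_mod_cast Units.ne_zero _
  have hsign : padicValRat p ((Equiv.Perm.sign σ : ℤ) : ℚ) = 0 := by
    rcases Int.units_eq_one_or (Equiv.Perm.sign σ) with h | h
    · simp [h]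
    · simp [h, padicValRat.neg]
  have hfac : ∀ i ∈ (univ : Finset (Fin N)), M (σ i) i ≠ 0 := by
    intro i _ h0; exact hprod (Finset.prod_eq_zero (mem_univ i) h0)
  rw [padicValRat.mul hsgn0 hprod, hsign, zero_add, padicValRat_prod _ _ hfac]
  have h1 : ∀ i, -((padicValNat p (M (σ i) i).den : ℕ) : ℤ) ≤ padicValRat p (M (σ i) i) :=
    fun i => neg_den_le_padicValRat _
  have h2 : (∑ i, padicValNat p (M (σ i) i).den) ≤ A :=
    Finset.le_sup (f := fun σ : Equiv.Perm (Fin N) => ∑ i, padicValNat p (M (σ i) i).den) (mem_univ σ)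
  have h3 : -(A : ℤ) ≤ ∑ i, (-((padicValNat p (M (σ i) i).den : ℕ) : ℤ)) := by
    rw [Finset.sum_neg_distrib]
    have h2' : ((∑ i, padicValNat p (M (σ i) i).den : ℕ) : ℤ) ≤ (A : ℤ) := Int.ofNat_le.mpr h2
    rw [Nat.cast_sum] at h2'
    exact neg_le_neg h2'
  exact le_trans h3 (Finset.sum_le_sum (fun i _ => h1 i))

/-- DL1, row form (the statement typed in `SketchB6.lean`): `v_p(den det M) ≤ max_σ Σ_i v_p(den M_{i, σ i})`. -/
theorem det_den_padicValNat_le {N : ℕ} (M : Matrix (Fin N) (Fin N) ℚ) :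
    padicValNat p M.det.den ≤
      univ.sup (fun σ : Equiv.Perm (Fin N) => ∑ i, padicValNat p (M i (σ i)).den) := by
  have h := det_den_padicValNat_le_col (p := p) M.transpose
  rw [Matrix.det_transpose] at h
  simpa [Matrix.transpose_apply] using h

/-- DL1-row: the weaker row-lcm bound follows. -/
theorem det_den_padicValNat_le_rowlcm {N : ℕ} (M : Matrix (Fin N) (Fin N) ℚ) :
    padicValNat p M.det.den ≤ ∑ i, univ.sup (fun j : Fin N => padicValNat p (M i j).den) := by
  refine le_trans (det_den_padicValNat_le (p := p) M) (Finset.sup_le (fun σ _ => ?_))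
  exact Finset.sum_le_sum (fun i _ =>
    Finset.le_sup (f := fun j : Fin N => padicValNat p (M i j).den) (mem_univ (σ i)))

end

/-- **DL1 (assignment bound), `Fact`-free form** of `det_den_padicValNat_le` (the statement the cell sketch
`zi-p2/SketchB6.lean` typed as the Prop `DetDenAssignmentBound`): for every square rational matrix `M` and every prime `p`,
`v_p(den det M) ≤ max_σ Σ_i v_p(den M_{i, σ i})` (the «assignment bound» A_p of the cell's gramdet engine). -/
theorem detDenAssignmentBound (N : ℕ) (M : Matrix (Fin N) (Fin N) ℚ) (p : ℕ) (hp : p.Prime) :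
    padicValNat p (M.det).den ≤
      univ.sup (fun σ : Equiv.Perm (Fin N) => ∑ i, padicValNat p (M i (σ i)).den) := by
  haveI : Fact p.Prime := ⟨hp⟩
  exact det_den_padicValNat_le M

/-- **DL1-row (row-lcm bound), `Fact`-free form** of `det_den_padicValNat_le_rowlcm` (sketch name `DetDenRowBound`):
`v_p(den det M) ≤ Σ_i max_j v_p(den M_{i,j})` (the «row-lcm bound» R_p). -/
theorem detDenRowBound (N : ℕ) (M : Matrix (Fin N) (Fin N) ℚ) (p : ℕ) (hp : p.Prime) :
    padicValNat p (M.det).den ≤ ∑ i, univ.sup (fun j : Fin N => padicValNat p (M i j).den) := by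
  haveI : Fact p.Prime := ⟨hp⟩
  exact det_den_padicValNat_le_rowlcm M

/-! ## §2 DL2 — one-threshold index laws: one permutation serves every row (A = R) -/

/-- Block reversal: identity on `i < i₀`, the reversal `i ↦ N - 1 + i₀ - i` on `i₀ ≤ i ≤ N - 1`. -/
def blockRev (N i₀ : ℕ) (i : Fin N) : Fin N :=
  if h : (i : ℕ) < i₀ then i else ⟨N - 1 + i₀ - i, by have := i.isLt; omega⟩

/-- Value of the block reversal: `i` below `i₀`, `N - 1 + i₀ - i` from `i₀` on. -/
@[simp] theorem blockRev_val (N i₀ : ℕ) (i : Fin N) :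
    ((blockRev N i₀ i : Fin N) : ℕ) = if (i : ℕ) < i₀ then (i : ℕ) else N - 1 + i₀ - i := by
  unfold blockRev
  split_ifs <;> rfl

/-- The block reversal is an involution. -/
theorem blockRev_involutive (N i₀ : ℕ) : Function.Involutive (blockRev N i₀) := by
  intro i
  have hi := i.isLt
  apply Fin.ext
  rw [blockRev_val, blockRev_val]
  split_ifs <;> omega

/-- The permutation realising every row's threshold simultaneously. -/
def blockRevPerm (N i₀ : ℕ) : Equiv.Perm (Fin N) :=
  Function.Involutive.toPerm (blockRev N i₀) (blockRev_involutive N i₀)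

/-- `blockRevPerm` acts as `blockRev`. -/
@[simp] theorem blockRevPerm_apply (N i₀ : ℕ) (i : Fin N) :
    blockRevPerm N i₀ i = blockRev N i₀ i := rfl

/-- **DL2 (one-threshold index laws: no gain).** For a one-threshold monotone index law `k₀ ≤ r + i + j` on an `N × N`
index set, ONE permutation `σ` (the block reversal at `i₀ := k₀ - r - (N-1)`) reaches the threshold in every row `i` that can
reach it at all (i.e. with `k₀ ≤ r + i + (N-1)`); hence the DL1 assignment bound equals the row-lcm bound for such laws
(the statement the cell sketch typed as the Prop `OneStepNoGain`). -/
theorem oneStepNoGain (N r k₀ : ℕ) :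
    ∃ σ : Equiv.Perm (Fin N), ∀ i : Fin N, k₀ ≤ r + i + (N - 1) → k₀ ≤ r + i + σ i := by
  refine ⟨blockRevPerm N (k₀ - r - (N - 1)), fun i hi => ?_⟩
  have hlt := i.isLt
  rw [blockRevPerm_apply, blockRev_val]
  split_ifs with h <;> omega

/-- Certified instance (`N = 4`, `r = 0`, `k₀ = 5`, so `i₀ = 2`): the permutation is `(0,1,3,2)`
and rows `2, 3` (the only ones with `i + 3 ≥ 5`) get `i + σ i = 5`. -/
example : ((List.finRange 4).map (fun i => ((blockRevPerm 4 2 i : Fin 4) : ℕ))) = [0, 1, 3, 2] := by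
  decide

/-! ## §3 DL2-max — max-type laws (one threshold per coordinate), 2-D and `d`-D forms -/

/-- 1-D key fact (DL2): with `i₀ := k₀ - r - (N-1)` every row that can reach the threshold reaches it. -/
theorem blockRevPerm_reaches (N r k₀ : ℕ) (i : Fin N) (hi : k₀ ≤ r + i + (N - 1)) :
    k₀ ≤ r + i + (blockRevPerm N (k₀ - r - (N - 1)) i : ℕ) := by
  have hlt := i.isLt
  rw [blockRevPerm_apply, blockRev_val]
  split_ifs with h <;> omega

/-- **DL2-max, 2-D form.** Entry law = OR of one threshold per coordinate (a «max-type» law): one permutation of the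
index set `Fin N × Fin N` (the product of the two 1-D block reversals) realises every row maximum at once
(sketch name `MaxLawNoGain2`). -/
theorem maxLawNoGain2 (N r₁ r₂ k₁ k₂ : ℕ) :
    ∃ σ : Equiv.Perm (Fin N × Fin N), ∀ i : Fin N × Fin N,
      (k₁ ≤ r₁ + i.1 + (N - 1) ∨ k₂ ≤ r₂ + i.2 + (N - 1)) →
      (k₁ ≤ r₁ + i.1 + (σ i).1 ∨ k₂ ≤ r₂ + i.2 + (σ i).2) := by
  refine ⟨Equiv.prodCongr (blockRevPerm N (k₁ - r₁ - (N - 1))) (blockRevPerm N (k₂ - r₂ - (N - 1))),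
    fun i hi => ?_⟩
  rcases hi with h | h
  · left
    simpa only [Equiv.prodCongr_apply, Prod.map] using blockRevPerm_reaches N r₁ k₁ i.1 h
  · right
    simpa only [Equiv.prodCongr_apply, Prod.map] using blockRevPerm_reaches N r₂ k₂ i.2 h

/-- **DL2-max, `d`-dimensional form** (indices `Fin d → Fin N`, one threshold `k c` and offset `r c` per coordinate
`c`; the entry law fires iff SOME coordinate reaches its threshold): the coordinatewise product of 1-D block reversals serves
every row (sketch name `MaxLawNoGainPi`). -/
theorem maxLawNoGainPi (d N : ℕ) (r k : Fin d → ℕ) :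
    ∃ σ : Equiv.Perm (Fin d → Fin N), ∀ i : Fin d → Fin N,
      (∃ c, k c ≤ r c + i c + (N - 1)) → ∃ c, k c ≤ r c + i c + σ i c := by
  refine ⟨Equiv.piCongrRight (fun c => blockRevPerm N (k c - r c - (N - 1))), fun i hi => ?_⟩
  obtain ⟨c, hc⟩ := hi
  exact ⟨c, by simpa [Equiv.piCongrRight] using blockRevPerm_reaches N (r c) (k c) (i c) hc⟩

/-- The converse direction is trivial bookkeeping (A ≤ R always: an assignment picks one entry per
row, whose exponent is at most the row maximum), so under a max-type one-threshold law A = R.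
Recorded here as the pointwise statement actually used: the realised exponent never exceeds the
row maximum because `σ i c ≤ N - 1`. -/
theorem realised_le_rowmax (d N : ℕ) (r : Fin d → ℕ) (σ : Equiv.Perm (Fin d → Fin N))
    (i : Fin d → Fin N) (c : Fin d) : r c + i c + σ i c ≤ r c + i c + (N - 1) := by
  have := (σ i c).isLt
  omega

/-- Certified instance (2-D, `N = 3`, offsets `0`, thresholds `k₁ = k₂ = 3`, so `i₀ = 1` in each
coordinate): the product permutation sends `(a, b) ↦ (ρ a, ρ b)` with `ρ = (0, 2, 1)`, and every row
with `max(a, b) ≥ 1` gets `max(a + ρ a, b + ρ b) = 3`. -/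
example : ((List.finRange 3).map (fun a => ((blockRevPerm 3 1 a : Fin 3) : ℕ))) = [0, 2, 1] := by
  decide

example : ∀ i : Fin 3 × Fin 3, (3 ≤ (i.1 : ℕ) + 2 ∨ 3 ≤ (i.2 : ℕ) + 2) →
    (3 ≤ (i.1 : ℕ) + (blockRevPerm 3 1 i.1 : ℕ) ∨ 3 ≤ (i.2 : ℕ) + (blockRevPerm 3 1 i.2 : ℕ)) := by
  decide

/-! ## §4 DL3 (ii) — sum-law boundary instance: A < R at `N = 2` -/

namespace SumLaw

/-- Number of rows `i` of `Fin N × Fin N` whose threshold `k₀ ≤ i₁+i₂+j₁+j₂` is met by the column `σ i`. -/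
def served (N k₀ : ℕ) (σ : Equiv.Perm (Fin N × Fin N)) : ℕ :=
  (Finset.univ.filter fun i : Fin N × Fin N =>
    k₀ ≤ (i.1 : ℕ) + i.2 + (σ i).1 + (σ i).2).card

/-- Number of rows that can reach the threshold at all (the row-lcm count `R`). -/
def reachable (N k₀ : ℕ) : ℕ :=
  (Finset.univ.filter fun i : Fin N × Fin N => k₀ ≤ (i.1 : ℕ) + i.2 + (N - 1) + (N - 1)).card

/-- `R = 3` for `N = 2`, `k₀ = 3`. -/
theorem reachable_two_three : reachable 2 3 = 3 := by decide

/-- `A ≤ 2`: no permutation of the four indices serves three rows … -/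
theorem served_two_three_le (σ : Equiv.Perm (Fin 2 × Fin 2)) : served 2 3 σ ≤ 2 := by
  revert σ; decide

/-- … and two are served (e.g. by the coordinatewise swap), so `A = 2`. -/
theorem served_two_three_eq_two : ∃ σ : Equiv.Perm (Fin 2 × Fin 2), served 2 3 σ = 2 := by decide

/-- **DL3 (ii) boundary instance**: for the sum law at `N = 2`, `k₀ = 3` the assignment count is STRICTLY below the
row-lcm count: `max_σ served = 2 < 3 = reachable`. -/
theorem sumLaw_assignment_lt_rowlcm_two_three :
    (∀ σ : Equiv.Perm (Fin 2 × Fin 2), served 2 3 σ < reachable 2 3) ∧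
      ∃ σ : Equiv.Perm (Fin 2 × Fin 2), served 2 3 σ = 2 := by
  refine ⟨fun σ => ?_, served_two_three_eq_two⟩
  rw [reachable_two_three]
  exact Nat.lt_of_le_of_lt (served_two_three_le σ) (by norm_num)

end SumLaw

end Summit.KontsevichZagierPeriods.Zeta5Search.DetDenom
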